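import Summits.QuantumFields.YangMills.Theorems.BalabanUVNodesN15CurvedGluingSmoothCutDressedGluedAdjointRightInverseDefect
import Summits.QuantumFields.YangMills.Theorems.BalabanUVNodesN15CurvedGluingCubeSmoothCutAdjointLetterDefect
import HarnessLib

/-!
# THE TWO-SPACING η-DEFECT OF ENTRY 2 `Y∘∇⁻_ν`, THE TRUE RIGHT-LOCALITY DEFECTS PRODUCED FROM FLAT DATA AT BOTH GRIDS — n15-c∕169 ★★★ with `hloc`∕`hEd` (both grids) and `hDEd`
# DERIVED by FILE 148 (`Ẽ = Ñ_𝒲∘F^flat`, rows, η-defect), the adjoint letters DERIVED by FILE 150 (both grids) and their η-defect by FILE 151, no far defect (global species models)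
# (dag-n15-c g19, n15-c∕174; N15 = NE2, s1 road (c) — the two-grid shape the cover∕small-field files instantiate)

Cell `pub-ymgap`, seat `pub-ymgap-dag-n15-c` (R134 (a); HUMAN RULING D-0062), generation 19.  `bears_on: R4∕N15 · K3⁸ SpineGivenEndpointR13SepCoPHV (stmt-QuantumFields-27366)`.
Filed `--kind proof --supports stmt-QuantumFields-27366 --as helper` — COUNT-NEUTRAL.  Theorems only; 0 `def`, 0 `sorry`.  Imports BY NAME n15-c∕169 `…SmoothCutDressedGluedAdjointRightInverseDefect`
(★★★ `hasMaj_idef_rightInverse_bgrad_smoothCutDressed`), FILE 151 `…CurvedGluingCubeSmoothCutAdjointLetterDefect` (★★★ `hasMaj_idef_adjW_smoothCut_loc₂`; through it FILE 150 ★★★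
`hasMaj_adjW_smoothCut_loc₂`, FILE 148 `projO_dressedV_comp_lap_mulOp` ∕ `hasMaj_neumannR_comp_loc₂` ∕ `hasMaj_idef_neumannR_comp_loc₂` ∕ `isUnit_neumannR`).  Nothing in the tree is modified.

WHY ∕ WHAT.  The two-grid twin of n15-c∕173: ★★★ `hasMaj_idef_rightInverse_bgrad_smoothCutDressed_of_flat` = n15-c∕169's hypotheses with `hcov(′)`∕`hFK(′)`∕`hDFK`∕`hloc(′)`∕`hEd(′)`∕`hDEd`∕
`hW𝒲(′)`∕`hD𝒲` REPLACED by the global models `hcov₀(′)`, the cut flat cubes' right-locality defects `hflat(′)` with cuts `hFlχ(′)`∕`hFlψ(′)`, rows `hFl(′)` and η-defect `hDFl` (rate `ρ₁`),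
the species letters `hC(′)`∕`hgA…` and fits `hfC`∕`hfgA…`, the cut cube rows' and the sandwiched entries' cut η-defects `hIcut`∕`hITf`∕`hITb`, aligned box cuts `hχπ`, idempotent cuts `hχχ(′)`,
and the dominated letters `hθAle` (FILE 150), `hr𝒲le` (FILE 151), `hεFle`∕`hrFEle` (FILE 148 §3); right entries' rows∕η-defects at the cut-row rate `δ`; `ρ₂ + 2σ ≤ ρ₁ ≤ δ_N`.  SAME
conclusion as n15-c∕169 (far letters `θ_F`, `r_{FK}` kept as slack).

HONEST FRAMING ∕ LIMITS.  Composition of LANDED∕typed theorems over DISPLAYED rows on dag-n15-a's model carriers; proves NO estimate of a concrete propagator; nothing of [B5]∕[B6]∕[B9]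
asserted (Thm 3.14 pp.426–427 = difference TEMPLATE; (2.91)–(2.93) p.239, (2.133)–(2.136) p.247, (3.42) p.397, (3.62)–(3.65) pp.402–403 = SHAPES ∕ MECHANISM).  NE2 for non-abelian
`G(U)` NOT proved (C-N15-1); N15 booked «discharged AS CONSUMED at the U-blind v7 pin» (№253) — road (c)'s bookkeeping, NO count; K3⁸ skeleton untouched; one finite 𝕋⁴ at fixed ε — NOT
infinite volume, NOT OS, NOT a mass gap, NOT Clay.  Restate-immune (no Theses import).
-/

set_option autoImplicit false

noncomputable section
open scoped BigOperators Matrix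
open Finset

namespace Summit.QuantumFields.YangMills.BalabanUVNodes.N15.Gluing

open Literature.MathematicalPhysics.QuantumFieldTheory.Balaban1983to89
open Literature.MathematicalPhysics.QuantumFieldTheory.Balaban1983to89.B11SectG (BlockNorm HasMaj RowSum hasMaj_zero)
open Literature.MathematicalPhysics.QuantumFieldTheory.Balaban1983to89.B6RandomWalk (Triangle254)
open Literature.MathematicalPhysics.QuantumFieldTheory.Balaban1983to89.T4EtaRateDefect (idef idef_comp idef_add idef_zero)
open Literature.MathematicalPhysics.QuantumFieldTheory.Balaban1983to89.T4EtaRateCoeffDefect (pull diagK diagK_nonneg hasMaj_mulOp)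
open Literature.MathematicalPhysics.QuantumFieldTheory.Balaban1983to89.B6Prop26Gluing (mulOp mulOp_apply ind ind_nonneg ind_le_one)
open Summit.QuantumFields.YangMills.BalabanUVNodes.N15.MatrixSpecies (mmulOp liftBlk liftMap liftEquiv liftEquiv_apply liftEquiv_symm_apply)
open Summit.QuantumFields.YangMills.BalabanUVNodes.N15.BackgroundLayer (fgrad bgrad fgradAdj fgrad_apply bgrad_apply stack projO unstackM bgPropV blkPair fgradMat)
open Summit.QuantumFields.YangMills.BalabanUVNodes.N15.CurvedSpecies (hasMaj_smoothCut_flat hasMaj_jet_smoothCut_flat smoothCut_out hasMaj_dressedV_pair)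

variable {X X' ι J K : Type} [Fintype X] [Fintype X'] [DecidableEq X] [DecidableEq X'] [Fintype ι] [DecidableEq ι] [Fintype J] [DecidableEq J] [Fintype K] {g : B6.Geometry}
  (blk : X → g.Site) (π : X' → X) (τ : J → X ≃ X) (τ' : J → X' ≃ X') (n n' : ℝ) (ν : J)
  {σ cr : ℝ} {N : K → (X × ι → ℝ) →ₗ[ℝ] (X × ι → ℝ)} {N' : K → (X' × ι → ℝ) →ₗ[ℝ] (X' × ι → ℝ)} {C : K → X → Matrix ι ι ℝ} {C' : K → X' → Matrix ι ι ℝ}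
  {A : K → J ⊕ J → X → Matrix ι ι ℝ} {A' : K → J ⊕ J → X' → Matrix ι ι ℝ} {NV : K → (X × ι → ℝ) →ₗ[ℝ] (X × ι → ℝ)} {NV' : K → (X' × ι → ℝ) →ₗ[ℝ] (X' × ι → ℝ)}
  {Δ NL Yop : (X × ι → ℝ) →ₗ[ℝ] (X × ι → ℝ)} {Δ' NL' Yop' : (X' × ι → ℝ) →ₗ[ℝ] (X' × ι → ℝ)} {Fl : K → (X × ι → ℝ) →ₗ[ℝ] (X × ι → ℝ)} {Fl' : K → (X' × ι → ℝ) →ₗ[ℝ] (X' × ι → ℝ)}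
  {χX χtX ψX ψ₂X hX : K → X → ℝ} {χX' χtX' ψX' ψ₂X' hX' : K → X' → ℝ} {Sk : K → Set g.Site} {hb : K → g.Site → ℝ}
  {Tf Tb : K → J → (X × ι → ℝ) →ₗ[ℝ] (X × ι → ℝ)} {Tf' Tb' : K → J → (X' × ι → ℝ) →ₗ[ℝ] (X' × ι → ℝ)}

set_option maxHeartbeats 1600000 in
/-- ★★★ **THE TWO-SPACING η-DEFECT OF ENTRY 2 `Y∘∇⁻_ν` FOR ANY RIGHT INVERSES AT TWO GRIDS, FROM FLAT DATA**: n15-c∕169 ★★★ with the true right-locality defects `Ẽ := Ñ_𝒲∘F^flat` at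
both grids and their η-defect produced by FILE 148, the adjoint letters by FILES 150∕151, no far defect. [cite: Balaban1985BackgroundPropagators, Thm 3.14 pp.426–427 (difference template),
(3.42) p.397 (entry 2: shape), (3.62)–(3.65) pp.402–403 (mechanism); Balaban1984PropagatorsII, (2.91)–(2.93) p.239, (2.133)–(2.136) p.247] -/
theorem hasMaj_idef_rightInverse_bgrad_smoothCutDressed_of_flat     (htri : Triangle254 g) (hd : ∀ a b : g.Site, 0 ≤ g.dist a b) (hsymm : ∀ y y', g.dist y y' = g.dist y' y) (hd0 : ∀ y : g.Site, g.dist y y = 0) (hrow : RowSum g σ cr) (hσ : 0 ≤ σ)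
    {ρ₁ ρ₂ ρ₃ ρN δV δN ε R c₀ c₁ c₂ o₀ o₁ o₂ o cN rN rA oAt RN rV ℓ ω β β₁ ct δ βQ θA mX mQ r𝒲 oχ θF εF rFK rFE os oχc rC r₁ εFl rFl mN mT oC og Nov : ℝ}
    (hβ : 0 ≤ β) (hβ₁ : 0 ≤ β₁) (hβQ : 0 ≤ βQ) (hct : 0 ≤ ct) (hR : 0 ≤ R) (hcr : 0 ≤ cr) (hc₀ : 0 ≤ c₀) (hc₁ : 0 ≤ c₁) (hc₂ : 0 ≤ c₂) (ho₀ : 0 ≤ o₀) (ho₁ : 0 ≤ o₁) (ho₂ : 0 ≤ o₂) (ho : 0 ≤ o)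
    (hcN : 0 ≤ cN) (hrN : 0 ≤ rN) (hrA : 0 ≤ rA) (hoAt : 0 ≤ oAt) (hRN : 0 ≤ RN) (hrV : 0 ≤ rV) (hℓ : 0 ≤ ℓ) (hω : 0 ≤ ω) (hθA : 0 ≤ θA) (hmX : 0 ≤ mX) (hmQ : 0 ≤ mQ) (hr𝒲 : 0 ≤ r𝒲)
    (hoχ : 0 ≤ oχ) (hε : 0 < ε) (hθF : 0 ≤ θF) (hεF : 0 ≤ εF) (hrFK : 0 ≤ rFK) (hrFE : 0 ≤ rFE) (hos : 0 ≤ os) (hoχc : 0 ≤ oχc) (hNov : 0 ≤ Nov)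
    (hrC : 0 ≤ rC) (hr₁ : 0 ≤ r₁) (hεFl : 0 ≤ εFl) (hrFl : 0 ≤ rFl) (hmN : 0 ≤ mN) (hmT : 0 ≤ mT) (hoC : 0 ≤ oC) (hog : 0 ≤ og)
    (hσρ : σ ≤ ρ₁) (hρ₁V : ρ₁ ≤ δV) (hρ₁G : ρ₁ + σ ≤ δ) (hρ₂ : 0 ≤ ρ₂) (hρ₂₁ : ρ₂ + σ ≤ ρ₁) (hρ₃ : 0 ≤ ρ₃) (hρ₃N : ρ₃ ≤ ρN) (hρ₃V : ρ₃ ≤ δN - ε) (hρ₃₂ : ρ₃ + σ ≤ ρ₂) (hρ₂W : ρ₂ + 2 * σ ≤ ρ₁)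
    (hρ₁N : ρ₁ ≤ δN) (hσρ₃ : 2 * σ ≤ ρ₃) (hSχ : ∀ q, ∀ x, (χX q) x ≠ 0 → blk x ∈ (Sk q)) (hSψ₂ : ∀ q, ∀ x, (ψ₂X q) x ≠ 0 → blk x ∈ (Sk q)) (hχt : ∀ q, ∀ x, |(χtX q) x| ≤ 1)
    (hdχt : ∀ q, ∀ μ p, |fgrad n (liftEquiv (τ μ) ι) (fun p : X × ι => (χtX q) p.1) p| ≤ ct) (hdχtb : ∀ q, ∀ μ p, |bgrad n (liftEquiv (τ μ) ι) (fun p : X × ι => (χtX q) p.1) p| ≤ ct)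
    (hsub : ∀ q, mulOp (fun p : X × ι => (χtX q) p.1) ∘ₗ mulOp (fun p : X × ι => (χX q) p.1) = mulOp (fun p : X × ι => (χtX q) p.1))
    (hχ : ∀ q, mulOp (fun p : X × ι => (χX q) p.1) ∘ₗ mulOp (fun p : X × ι => (χtX q) p.1) = mulOp (fun p : X × ι => (χtX q) p.1))
    (hs : ∀ q, ∀ μ, mulOp ((fun p : X × ι => (χtX q) p.1) ∘ (liftEquiv (τ μ) ι)) ∘ₗ mulOp (fun p : X × ι => (χX q) p.1) = mulOp ((fun p : X × ι => (χtX q) p.1) ∘ (liftEquiv (τ μ) ι)))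
    (hsb : ∀ q, ∀ μ, mulOp ((fun p : X × ι => (χtX q) p.1) ∘ (liftEquiv (τ μ) ι).symm) ∘ₗ mulOp (fun p : X × ι => (χX q) p.1) = mulOp ((fun p : X × ι => (χtX q) p.1) ∘ (liftEquiv (τ μ) ι).symm))
    (hdd : ∀ q, ∀ μ, mulOp (fgrad n (liftEquiv (τ μ) ι) (fun p : X × ι => (χtX q) p.1)) ∘ₗ mulOp (fun p : X × ι => (χX q) p.1) = mulOp (fgrad n (liftEquiv (τ μ) ι) (fun p : X × ι => (χtX q) p.1)))
    (hddb : ∀ q, ∀ μ, mulOp (bgrad n (liftEquiv (τ μ) ι) (fun p : X × ι => (χtX q) p.1)) ∘ₗ mulOp (fun p : X × ι => (χX q) p.1) = mulOp (bgrad n (liftEquiv (τ μ) ι) (fun p : X × ι => (χtX q) p.1)))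
    (hSχ' : ∀ q, ∀ x', (χX' q) x' ≠ 0 → blk (π x') ∈ (Sk q)) (hSψ' : ∀ q, ∀ x', (ψX' q) x' ≠ 0 → blk (π x') ∈ (Sk q)) (hSψ₂' : ∀ q, ∀ x', (ψ₂X' q) x' ≠ 0 → blk (π x') ∈ (Sk q))
    (hχt' : ∀ q, ∀ x', |(χtX' q) x'| ≤ 1) (hdχt' : ∀ q, ∀ μ p', |fgrad n' (liftEquiv (τ' μ) ι) (fun p : X' × ι => (χtX' q) p.1) p'| ≤ ct)
    (hdχtb' : ∀ q, ∀ μ p', |bgrad n' (liftEquiv (τ' μ) ι) (fun p : X' × ι => (χtX' q) p.1) p'| ≤ ct)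
    (hsub' : ∀ q, mulOp (fun p : X' × ι => (χtX' q) p.1) ∘ₗ mulOp (fun p : X' × ι => (χX' q) p.1) = mulOp (fun p : X' × ι => (χtX' q) p.1))
    (hχ' : ∀ q, mulOp (fun p : X' × ι => (χX' q) p.1) ∘ₗ mulOp (fun p : X' × ι => (χtX' q) p.1) = mulOp (fun p : X' × ι => (χtX' q) p.1))
    (hs' : ∀ q, ∀ μ, mulOp ((fun p : X' × ι => (χtX' q) p.1) ∘ (liftEquiv (τ' μ) ι)) ∘ₗ mulOp (fun p : X' × ι => (χX' q) p.1) = mulOp ((fun p : X' × ι => (χtX' q) p.1) ∘ (liftEquiv (τ' μ) ι)))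
    (hsb' : ∀ q, ∀ μ, mulOp ((fun p : X' × ι => (χtX' q) p.1) ∘ (liftEquiv (τ' μ) ι).symm) ∘ₗ mulOp (fun p : X' × ι => (χX' q) p.1) = mulOp ((fun p : X' × ι => (χtX' q) p.1) ∘ (liftEquiv (τ' μ) ι).symm))
    (hdd' : ∀ q, ∀ μ, mulOp (fgrad n' (liftEquiv (τ' μ) ι) (fun p : X' × ι => (χtX' q) p.1)) ∘ₗ mulOp (fun p : X' × ι => (χX' q) p.1) = mulOp (fgrad n' (liftEquiv (τ' μ) ι) (fun p : X' × ι => (χtX' q) p.1)))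
    (hddb' : ∀ q, ∀ μ, mulOp (bgrad n' (liftEquiv (τ' μ) ι) (fun p : X' × ι => (χtX' q) p.1)) ∘ₗ mulOp (fun p : X' × ι => (χX' q) p.1) = mulOp (bgrad n' (liftEquiv (τ' μ) ι) (fun p : X' × ι => (χtX' q) p.1)))
    (hNψ' : ∀ q, (N' q) ∘ₗ mulOp (fun p : X' × ι => (ψX' q) p.1) = (N' q)) (hfitχ : ∀ q, ∀ x', |(χtX' q) x' - (χtX q) (π x')| ≤ oχ)
    (hcut : ∀ q, HasMaj (BlockNorm.ofBlocks g (liftBlk blk ι)) (BlockNorm.ofBlocks g (liftBlk blk ι)) (mulOp (fun p : X × ι => (χX q) p.1) ∘ₗ (N q)) (fun y y' => ind (Sk q) y * ind (Sk q) y' * (β * Real.exp (-(δ * g.dist y y')))))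
    (hcutF : ∀ q, ∀ μ, HasMaj (BlockNorm.ofBlocks g (liftBlk blk ι)) (BlockNorm.ofBlocks g (liftBlk blk ι)) (mulOp (fun p : X × ι => (χX q) p.1) ∘ₗ (fgrad n (liftEquiv (τ μ) ι) ∘ₗ (N q)))
      (fun y y' => ind (Sk q) y * ind (Sk q) y' * (β₁ * Real.exp (-(δ * g.dist y y')))))
    (hcutB : ∀ q, ∀ μ, HasMaj (BlockNorm.ofBlocks g (liftBlk blk ι)) (BlockNorm.ofBlocks g (liftBlk blk ι)) (mulOp (fun p : X × ι => (χX q) p.1) ∘ₗ (bgrad n (liftEquiv (τ μ) ι) ∘ₗ (N q)))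
      (fun y y' => ind (Sk q) y * ind (Sk q) y' * (β₁ * Real.exp (-(δ * g.dist y y')))))
    (hcut' : ∀ q, HasMaj (BlockNorm.ofBlocks g (liftBlk (blk ∘ π) ι)) (BlockNorm.ofBlocks g (liftBlk (blk ∘ π) ι)) (mulOp (fun p : X' × ι => (χX' q) p.1) ∘ₗ (N' q)) (fun y y' => ind (Sk q) y * ind (Sk q) y' * (β * Real.exp (-(δ * g.dist y y')))))
    (hcutF' : ∀ q, ∀ μ, HasMaj (BlockNorm.ofBlocks g (liftBlk (blk ∘ π) ι)) (BlockNorm.ofBlocks g (liftBlk (blk ∘ π) ι)) (mulOp (fun p : X' × ι => (χX' q) p.1) ∘ₗ (fgrad n' (liftEquiv (τ' μ) ι) ∘ₗ (N' q)))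
      (fun y y' => ind (Sk q) y * ind (Sk q) y' * (β₁ * Real.exp (-(δ * g.dist y y')))))
    (hcutB' : ∀ q, ∀ μ, HasMaj (BlockNorm.ofBlocks g (liftBlk (blk ∘ π) ι)) (BlockNorm.ofBlocks g (liftBlk (blk ∘ π) ι)) (mulOp (fun p : X' × ι => (χX' q) p.1) ∘ₗ (bgrad n' (liftEquiv (τ' μ) ι) ∘ₗ (N' q)))
      (fun y y' => ind (Sk q) y * ind (Sk q) y' * (β₁ * Real.exp (-(δ * g.dist y y')))))
    (hTf : ∀ q, ∀ μ, (N q) ∘ₗ fgrad n (liftEquiv (τ μ) ι) ∘ₗ mulOp (fun p : X × ι => (χX q) p.1) = (Tf q) μ ∘ₗ mulOp (fun p : X × ι => (χX q) p.1))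
    (hTb : ∀ q, ∀ μ, (N q) ∘ₗ bgrad n (liftEquiv (τ μ) ι) ∘ₗ mulOp (fun p : X × ι => (χX q) p.1) = (Tb q) μ ∘ₗ mulOp (fun p : X × ι => (χX q) p.1))
    (hTf' : ∀ q, ∀ μ, (N' q) ∘ₗ fgrad n' (liftEquiv (τ' μ) ι) ∘ₗ mulOp (fun p : X' × ι => (χX' q) p.1) = (Tf' q) μ ∘ₗ mulOp (fun p : X' × ι => (χX' q) p.1))
    (hTb' : ∀ q, ∀ μ, (N' q) ∘ₗ bgrad n' (liftEquiv (τ' μ) ι) ∘ₗ mulOp (fun p : X' × ι => (χX' q) p.1) = (Tb' q) μ ∘ₗ mulOp (fun p : X' × ι => (χX' q) p.1))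
    (hTfr : ∀ q, ∀ μ, HasMaj (BlockNorm.ofBlocks g (liftBlk blk ι)) (BlockNorm.ofBlocks g (liftBlk blk ι)) ((Tf q) μ) (fun y y' => ind (Sk q) y * ind (Sk q) y' * (βQ * Real.exp (-(δ * g.dist y y')))))
    (hTbr : ∀ q, ∀ μ, HasMaj (BlockNorm.ofBlocks g (liftBlk blk ι)) (BlockNorm.ofBlocks g (liftBlk blk ι)) ((Tb q) μ) (fun y y' => ind (Sk q) y * ind (Sk q) y' * (βQ * Real.exp (-(δ * g.dist y y')))))
    (hTfr' : ∀ q, ∀ μ, HasMaj (BlockNorm.ofBlocks g (liftBlk (blk ∘ π) ι)) (BlockNorm.ofBlocks g (liftBlk (blk ∘ π) ι)) ((Tf' q) μ) (fun y y' => ind (Sk q) y * ind (Sk q) y' * (βQ * Real.exp (-(δ * g.dist y y')))))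
    (hTbr' : ∀ q, ∀ μ, HasMaj (BlockNorm.ofBlocks g (liftBlk (blk ∘ π) ι)) (BlockNorm.ofBlocks g (liftBlk (blk ∘ π) ι)) ((Tb' q) μ) (fun y y' => ind (Sk q) y * ind (Sk q) y' * (βQ * Real.exp (-(δ * g.dist y y')))))
    (hTfψ : ∀ q, ∀ μ, (Tf q) μ ∘ₗ mulOp (fun p : X × ι => (ψ₂X q) p.1) = (Tf q) μ) (hTbψ : ∀ q, ∀ μ, (Tb q) μ ∘ₗ mulOp (fun p : X × ι => (ψ₂X q) p.1) = (Tb q) μ)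
    (hTfψ' : ∀ q, ∀ μ, (Tf' q) μ ∘ₗ mulOp (fun p : X' × ι => (ψ₂X' q) p.1) = (Tf' q) μ) (hTbψ' : ∀ q, ∀ μ, (Tb' q) μ ∘ₗ mulOp (fun p : X' × ι => (ψ₂X' q) p.1) = (Tb' q) μ)
    (hDTf : ∀ q, ∀ μ, HasMaj (BlockNorm.ofBlocks g (liftBlk blk ι)) (BlockNorm.ofBlocks g (liftBlk (blk ∘ π) ι)) (idef (pull (liftMap π ι)) (pull (liftMap π ι)) ((Tf' q) μ) ((Tf q) μ)) (fun y y' => mQ * Real.exp (-(δ * g.dist y y'))))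
    (hDTb : ∀ q, ∀ μ, HasMaj (BlockNorm.ofBlocks g (liftBlk blk ι)) (BlockNorm.ofBlocks g (liftBlk (blk ∘ π) ι)) (idef (pull (liftMap π ι)) (pull (liftMap π ι)) ((Tb' q) μ) ((Tb q) μ)) (fun y y' => mQ * Real.exp (-(δ * g.dist y y'))))
    (hV : ∀ q, HasMaj (BlockNorm.ofBlocks g (blkPair (liftBlk blk ι))) (BlockNorm.ofBlocks g (liftBlk blk ι)) (unstackM (C q) (A q) + (NV q) ∘ₗ projO (none : Option (J ⊕ J))) (fun y y' => R * Real.exp (-(δV * g.dist y y'))))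
    (hV' : ∀ q, HasMaj (BlockNorm.ofBlocks g (blkPair (liftBlk (blk ∘ π) ι))) (BlockNorm.ofBlocks g (liftBlk (blk ∘ π) ι)) (unstackM (C' q) (A' q) + (NV' q) ∘ₗ projO (none : Option (J ⊕ J))) (fun y y' => R * Real.exp (-(δV * g.dist y y'))))
    (hq : (β + (β₁ + ct * β)) * (R * cr) * cr < 1) (hqA : θA * cr < 1) (hθAle : β * rC + Fintype.card J * (2 * (βQ * rA + β * r₁)) + β * RN * cr ≤ θA)
    (hr𝒲le : (((β * oC + mN * rC) + Fintype.card J * (2 * ((βQ * oAt + mT * rA) + (β * og + mN * r₁))) + (β * rV + mN * RN) * cr) + oχ * (β * rC + Fintype.card J * (2 * (βQ * rA + β * r₁)) + β * RN * cr)) ≤ r𝒲)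
    (hεFle : (1 - θA * cr)⁻¹ * εFl * cr ≤ εF) (hrFEle : (1 - θA * cr)⁻¹ * rFl * cr + (1 - θA * cr)⁻¹ * (r𝒲 * ((1 - θA * cr)⁻¹ * εFl * cr) * cr) * cr ≤ rFE)
    (hDG0 : ∀ q, HasMaj (BlockNorm.ofBlocks g (liftBlk blk ι)) (BlockNorm.ofBlocks g (liftBlk (blk ∘ π) ι))
      (idef (pull (liftMap π ι)) (pull (liftMap π ι))
        (projO none ∘ₗ bgPropV (stack (mulOp (fun p : X' × ι => (χtX' q) p.1) ∘ₗ (N' q))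
          (fun j => Sum.elim (fun μ => fgrad n' (liftEquiv (τ' μ) ι)) (fun μ => bgrad n' (liftEquiv (τ' μ) ι)) j ∘ₗ (mulOp (fun p : X' × ι => (χtX' q) p.1) ∘ₗ (N' q)))) (unstackM (C' q) (A' q) + (NV' q) ∘ₗ projO (none : Option (J ⊕ J))))
        (projO none ∘ₗ bgPropV (stack (mulOp (fun p : X × ι => (χtX q) p.1) ∘ₗ (N q))
          (fun j => Sum.elim (fun μ => fgrad n (liftEquiv (τ μ) ι)) (fun μ => bgrad n (liftEquiv (τ μ) ι)) j ∘ₗ (mulOp (fun p : X × ι => (χtX q) p.1) ∘ₗ (N q)))) (unstackM (C q) (A q) + (NV q) ∘ₗ projO (none : Option (J ⊕ J)))))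
      (fun y y' => ind (Sk q) y * ind (Sk q) y' * (mX * Real.exp (-(ρ₂ * g.dist y y')))))
    (hhD : ∀ q, ∀ μ p, |(fgrad n (liftEquiv (τ μ) ι) (fun p : X × ι => (hX q) p.1) ∘ ⇑(liftEquiv (τ μ) ι).symm) p| ≤ c₁)
    (hhB : ∀ q, ∀ μ p, |(bgrad n (liftEquiv (τ μ) ι) (fun p : X × ι => (hX q) p.1) ∘ ⇑(liftEquiv (τ μ) ι)) p| ≤ c₁)
    (hh2 : ∀ q, ∀ μ p, |fgradAdj n (liftEquiv (τ μ) ι) (fgrad n (liftEquiv (τ μ) ι) (fun p : X × ι => (hX q) p.1)) p| ≤ c₂)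
    (hh2f : ∀ q, ∀ μ p, |(fgrad n (liftEquiv (τ μ) ι) (fgrad n (liftEquiv (τ μ) ι) (fun p : X × ι => (hX q) p.1)) ∘ ⇑(liftEquiv (τ μ) ι).symm) p| ≤ c₂)
    (hh2b : ∀ q, ∀ μ p, |bgrad n (liftEquiv (τ μ) ι) (bgrad n (liftEquiv (τ μ) ι) (fun p : X × ι => (hX q) p.1) ∘ ⇑(liftEquiv (τ μ) ι)) p| ≤ c₂)
    (hfD : ∀ q, ∀ μ p', |(fgrad n' (liftEquiv (τ' μ) ι) (fun p : X' × ι => (hX' q) p.1) ∘ ⇑(liftEquiv (τ' μ) ι).symm) p' - (fgrad n (liftEquiv (τ μ) ι) (fun p : X × ι => (hX q) p.1) ∘ ⇑(liftEquiv (τ μ) ι).symm) (liftMap π ι p')| ≤ o₁)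
    (hfB : ∀ q, ∀ μ p', |(bgrad n' (liftEquiv (τ' μ) ι) (fun p : X' × ι => (hX' q) p.1) ∘ ⇑(liftEquiv (τ' μ) ι)) p' - (bgrad n (liftEquiv (τ μ) ι) (fun p : X × ι => (hX q) p.1) ∘ ⇑(liftEquiv (τ μ) ι)) (liftMap π ι p')| ≤ o₁)
    (hf2 : ∀ q, ∀ μ p', |fgradAdj n' (liftEquiv (τ' μ) ι) (fgrad n' (liftEquiv (τ' μ) ι) (fun p : X' × ι => (hX' q) p.1)) p' - fgradAdj n (liftEquiv (τ μ) ι) (fgrad n (liftEquiv (τ μ) ι) (fun p : X × ι => (hX q) p.1)) (liftMap π ι p')| ≤ o₂)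
    (hf2f : ∀ q, ∀ μ p', |(fgrad n' (liftEquiv (τ' μ) ι) (fgrad n' (liftEquiv (τ' μ) ι) (fun p : X' × ι => (hX' q) p.1)) ∘ ⇑(liftEquiv (τ' μ) ι).symm) p' -
      (fgrad n (liftEquiv (τ μ) ι) (fgrad n (liftEquiv (τ μ) ι) (fun p : X × ι => (hX q) p.1)) ∘ ⇑(liftEquiv (τ μ) ι).symm) (liftMap π ι p')| ≤ o₂)
    (hf2b : ∀ q, ∀ μ p', |bgrad n' (liftEquiv (τ' μ) ι) (bgrad n' (liftEquiv (τ' μ) ι) (fun p : X' × ι => (hX' q) p.1) ∘ ⇑(liftEquiv (τ' μ) ι)) p' -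
      bgrad n (liftEquiv (τ μ) ι) (bgrad n (liftEquiv (τ μ) ι) (fun p : X × ι => (hX q) p.1) ∘ ⇑(liftEquiv (τ μ) ι)) (liftMap π ι p')| ≤ o₂)
    (hh1 : ∀ q, ∀ μ x, |fgrad n (τ μ) (hX q) x| ≤ c₁) (hh1b : ∀ q, ∀ μ x, |bgrad n (τ μ) (hX q) x| ≤ c₁) (hh0 : ∀ q, ∀ μ x, |(hX q) (τ μ x) - (hX q) x| ≤ c₀)
    (hh1' : ∀ q, ∀ μ x', |fgrad n' (τ' μ) (hX' q) x'| ≤ c₁) (hh1b' : ∀ q, ∀ μ x', |bgrad n' (τ' μ) (hX' q) x'| ≤ c₁) (hh0' : ∀ q, ∀ μ x', |(hX' q) (τ' μ x') - (hX' q) x'| ≤ c₀)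
    (hf1 : ∀ q, ∀ μ x', |fgrad n' (τ' μ) (hX' q) x' - fgrad n (τ μ) (hX q) (π x')| ≤ o₁) (hf1b : ∀ q, ∀ μ x', |bgrad n' (τ' μ) (hX' q) x' - bgrad n (τ μ) (hX q) (π x')| ≤ o₁)
    (hf0 : ∀ q, ∀ μ x', |((hX' q) (τ' μ x') - (hX' q) x') - ((hX q) (τ μ (π x')) - (hX q) (π x'))| ≤ o₀)
    (hf0b : ∀ q, ∀ μ x', |((hX' q) x' - (hX' q) ((τ' μ).symm x')) - ((hX q) (π x') - (hX q) ((τ μ).symm (π x')))| ≤ o₀)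
    (hfit : ∀ q, ∀ x', |(hX' q) x' - (hX q) (π x')| ≤ o) (hLip : ∀ q, ∀ y y', |(hb q) y - (hb q) y'| ≤ ℓ * g.dist y y') (hrh : ∀ q, ∀ x, |(hX q) x - (hb q) (blk x)| ≤ ω)
    (hrh' : ∀ q, ∀ x', |(hX' q) x' - (hb q) (blk (π x'))| ≤ ω) (hlayf : ∀ q, ∀ μ x, (hX q) x ≠ (hX q) ((τ μ).symm x) → (χX q) x = 1)
    (hlayb : ∀ q, ∀ μ x, (hX q) (τ μ x) ≠ (hX q) x → (χX q) x = 1) (hlayf' : ∀ q, ∀ μ x', (hX' q) x' ≠ (hX' q) ((τ' μ).symm x') → (χX' q) x' = 1)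
    (hlayb' : ∀ q, ∀ μ x', (hX' q) (τ' μ x') ≠ (hX' q) x' → (χX' q) x' = 1) (hA : ∀ q, ∀ j x i, ∑ k, |(A q) j x i k| ≤ rA)
    (hfAb : ∀ q, ∀ μ x' i, ∑ k, |(A' q) (Sum.inl μ) ((τ' μ).symm x') i k - (A q) (Sum.inl μ) ((τ μ).symm (π x')) i k| ≤ oAt)
    (hfAf : ∀ q, ∀ μ x' i, ∑ k, |(A' q) (Sum.inr μ) (τ' μ x') i k - (A q) (Sum.inr μ) (τ μ (π x')) i k| ≤ oAt)
    (hKN : ∀ q, HasMaj (BlockNorm.ofBlocks g (liftBlk blk ι)) (BlockNorm.ofBlocks g (liftBlk blk ι)) (commOp NL (fun p : X × ι => (hX q) p.1)) (fun y y' => cN * Real.exp (-(ρN * g.dist y y'))))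
    (hDKN : ∀ q, HasMaj (BlockNorm.ofBlocks g (liftBlk blk ι)) (BlockNorm.ofBlocks g (liftBlk (blk ∘ π) ι))
      (idef (pull (liftMap π ι)) (pull (liftMap π ι)) (commOp NL' (fun p : X' × ι => (hX' q) p.1)) (commOp NL (fun p : X × ι => (hX q) p.1))) (fun y y' => rN * Real.exp (-(ρN * g.dist y y'))))
    (hNV : ∀ q, HasMaj (BlockNorm.ofBlocks g (liftBlk blk ι)) (BlockNorm.ofBlocks g (liftBlk blk ι)) (NV q) (fun y y' => RN * Real.exp (-(δN * g.dist y y'))))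
    (hNV' : ∀ q, HasMaj (BlockNorm.ofBlocks g (liftBlk (blk ∘ π) ι)) (BlockNorm.ofBlocks g (liftBlk (blk ∘ π) ι)) (NV' q) (fun y y' => RN * Real.exp (-(δN * g.dist y y'))))
    (hDNV : ∀ q, HasMaj (BlockNorm.ofBlocks g (liftBlk blk ι)) (BlockNorm.ofBlocks g (liftBlk (blk ∘ π) ι)) (idef (pull (liftMap π ι)) (pull (liftMap π ι)) (NV' q) (NV q)) (fun y y' => rV * Real.exp (-(δN * g.dist y y'))))
    -- the cut cube rows' η-defect, the sandwiched right entries' cut η-defects, aligned box cuts, idempotent cuts, species letters at both grids and their fits (FILES 150∕151)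
    (hIcut : ∀ q, HasMaj (BlockNorm.ofBlocks g (liftBlk blk ι)) (BlockNorm.ofBlocks g (liftBlk (blk ∘ π) ι)) (idef (pull (liftMap π ι)) (pull (liftMap π ι)) (mulOp (fun p : X' × ι => (χX' q) p.1) ∘ₗ (N' q)) (mulOp (fun p : X × ι => (χX q) p.1) ∘ₗ (N q))) (fun y y' => ind (Sk q) y * ind (Sk q) y' * (mN * Real.exp (-(δ * g.dist y y')))))
    (hITf : ∀ q, ∀ μ, HasMaj (BlockNorm.ofBlocks g (liftBlk blk ι)) (BlockNorm.ofBlocks g (liftBlk (blk ∘ π) ι)) (idef (pull (liftMap π ι)) (pull (liftMap π ι)) (mulOp (fun p : X' × ι => (χX' q) p.1) ∘ₗ (Tf' q) μ) (mulOp (fun p : X × ι => (χX q) p.1) ∘ₗ (Tf q) μ)) (fun y y' => ind (Sk q) y * ind (Sk q) y' * (mT * Real.exp (-(δ * g.dist y y')))))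
    (hITb : ∀ q, ∀ μ, HasMaj (BlockNorm.ofBlocks g (liftBlk blk ι)) (BlockNorm.ofBlocks g (liftBlk (blk ∘ π) ι)) (idef (pull (liftMap π ι)) (pull (liftMap π ι)) (mulOp (fun p : X' × ι => (χX' q) p.1) ∘ₗ (Tb' q) μ) (mulOp (fun p : X × ι => (χX q) p.1) ∘ₗ (Tb q) μ)) (fun y y' => ind (Sk q) y * ind (Sk q) y' * (mT * Real.exp (-(δ * g.dist y y')))))
    (hχπ : ∀ q x', χX' q x' = χX q (π x'))
    (hχχ : ∀ q, mulOp (fun p : X × ι => (χX q) p.1) ∘ₗ mulOp (fun p : X × ι => (χX q) p.1) = mulOp (fun p : X × ι => (χX q) p.1))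
    (hχχ' : ∀ q, mulOp (fun p : X' × ι => (χX' q) p.1) ∘ₗ mulOp (fun p : X' × ι => (χX' q) p.1) = mulOp (fun p : X' × ι => (χX' q) p.1))
    (hC : ∀ q x i, ∑ j, |(C q) x i j| ≤ rC) (hC' : ∀ q x' i, ∑ j, |(C' q) x' i j| ≤ rC)
    (hgAf : ∀ q μ x i, ∑ j, |fgradMat n (τ μ) ((A q) (Sum.inl μ)) x i j| ≤ r₁) (hgAb : ∀ q μ x i, ∑ j, |fgradMat n (τ μ) ((A q) (Sum.inr μ)) x i j| ≤ r₁)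
    (hgAf' : ∀ q μ x' i, ∑ j, |fgradMat n' (τ' μ) ((A' q) (Sum.inl μ)) x' i j| ≤ r₁) (hgAb' : ∀ q μ x' i, ∑ j, |fgradMat n' (τ' μ) ((A' q) (Sum.inr μ)) x' i j| ≤ r₁)
    (hfC : ∀ q x' i, ∑ j, |(C' q) x' i j - (C q) (π x') i j| ≤ oC)
    (hfgAf : ∀ q μ x' i, ∑ j, |fgradMat n' (τ' μ) ((A' q) (Sum.inl μ)) ((τ' μ).symm x') i j - fgradMat n (τ μ) ((A q) (Sum.inl μ)) ((τ μ).symm (π x')) i j| ≤ og)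
    (hfgAb : ∀ q μ x' i, ∑ j, |fgradMat n' (τ' μ) ((A' q) (Sum.inr μ)) x' i j - fgradMat n (τ μ) ((A q) (Sum.inr μ)) (π x') i j| ≤ og)
    -- per cube: coarse plateau support ∕ input cut (for the coarse cut row), sharp-cut letters and fit, the partition's absolute letters, its cut, the `ν`-shifted supports and fit
    (hSψ : ∀ q, ∀ x, (ψX q) x ≠ 0 → blk x ∈ (Sk q)) (hNψ : ∀ q, (N q) ∘ₗ mulOp (fun p : X × ι => (ψX q) p.1) = (N q)) (hχ1 : ∀ q x, |χX q x| ≤ 1) (hχ1' : ∀ q x', |χX' q x'| ≤ 1)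
    (hfitχc : ∀ q x', |χX' q x' - χX q (π x')| ≤ oχc) (hhabs : ∀ q x, |hX q x| ≤ 1) (hhabs' : ∀ q x', |hX' q x'| ≤ 1)
    (hhcut : ∀ q, mulOp (fun p : X × ι => (hX q) p.1) ∘ₗ mulOp (fun p : X × ι => (χX q) p.1) = mulOp (fun p : X × ι => (hX q) p.1))
    (hhcut' : ∀ q, mulOp (fun p : X' × ι => (hX' q) p.1) ∘ₗ mulOp (fun p : X' × ι => (χX' q) p.1) = mulOp (fun p : X' × ι => (hX' q) p.1))
    (hlayν : ∀ q x, hX q (τ ν x) ≠ 0 → χX q x = 1) (hlayν' : ∀ q x', hX' q (τ' ν x') ≠ 0 → χX' q x' = 1) (hfits : ∀ q x', |hX' q (τ' ν x') - hX q (τ ν (π x'))| ≤ os)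
    (hh2' : ∀ q, ∀ μ p', |fgradAdj n' (liftEquiv (τ' μ) ι) (fgrad n' (liftEquiv (τ' μ) ι) (fun p : X' × ι => (hX' q) p.1)) p'| ≤ c₂)
    (hh2f' : ∀ q, ∀ μ p', |fgrad n' (liftEquiv (τ' μ) ι) (fgrad n' (liftEquiv (τ' μ) ι) (fun p : X' × ι => (hX' q) p.1)) p'| ≤ c₂)
    (hh2b' : ∀ q, ∀ μ p', |bgrad n' (liftEquiv (τ' μ) ι) (bgrad n' (liftEquiv (τ' μ) ι) (fun p : X' × ι => (hX' q) p.1) ∘ ⇑(liftEquiv (τ' μ) ι)) p'| ≤ c₂)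
    (hA' : ∀ q, ∀ j x' i, ∑ k, |(A' q) j x' i k| ≤ rA)
    (hKN' : ∀ q, HasMaj (BlockNorm.ofBlocks g (liftBlk (blk ∘ π) ι)) (BlockNorm.ofBlocks g (liftBlk (blk ∘ π) ι)) (commOp NL' (fun p : X' × ι => (hX' q) p.1)) (fun y y' => cN * Real.exp (-(ρN * g.dist y y'))))
    (hN : ∀ a, ∑ q, ind (Sk q) a ≤ Nov)
    -- THE GLOBAL OPERATORS = the cubes' common models at both grids (flat part minus GLOBAL species, no far defect); the cut flat cubes' right locality on the partitions with defects `Fl`, `Fl′`: cuts, rows, η-defect; species letters and fits for FILES 150∕151; partition of unity; right inverses; ONE smallness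
    (h236 : ∀ p : X × ι, ∑ q, (fun p : X × ι => (hX q) p.1) p ^ 2 = 1) (h236' : ∀ p : X' × ι, ∑ q, (fun p : X' × ι => (hX' q) p.1) p ^ 2 = 1) (hY : Δ ∘ₗ Yop = LinearMap.id)
    (hY' : Δ' ∘ₗ Yop' = LinearMap.id)
    (hcov₀ : ∀ q, Δ = lapOp n (fun μ => liftEquiv (τ μ) ι) 0 + NL - (unstackM ((C q)) ((A q)) + (NV q) ∘ₗ projO (none : Option (J ⊕ J))) ∘ₗ stack LinearMap.id (fun j => Sum.elim (fun μ => fgrad n (liftEquiv (τ μ) ι)) (fun μ => bgrad n (liftEquiv (τ μ) ι)) j))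
    (hcov₀' : ∀ q, Δ' = lapOp n' (fun μ => liftEquiv (τ' μ) ι) 0 + NL' - (unstackM ((C' q)) ((A' q)) + (NV' q) ∘ₗ projO (none : Option (J ⊕ J))) ∘ₗ stack LinearMap.id (fun j => Sum.elim (fun μ => fgrad n' (liftEquiv (τ' μ) ι)) (fun μ => bgrad n' (liftEquiv (τ' μ) ι)) j))
    (hflat : ∀ q, (mulOp (fun p : X × ι => (χtX q) p.1) ∘ₗ (N q)) ∘ₗ (lapOp n (fun μ => liftEquiv (τ μ) ι) 0 + NL) ∘ₗ mulOp (fun p : X × ι => (hX q) p.1) = mulOp (fun p : X × ι => (hX q) p.1) + Fl q)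
    (hflat' : ∀ q, (mulOp (fun p : X' × ι => (χtX' q) p.1) ∘ₗ (N' q)) ∘ₗ (lapOp n' (fun μ => liftEquiv (τ' μ) ι) 0 + NL') ∘ₗ mulOp (fun p : X' × ι => (hX' q) p.1) = mulOp (fun p : X' × ι => (hX' q) p.1) + Fl' q)
    (hFlχ : ∀ q, mulOp (fun p : X × ι => (χX q) p.1) ∘ₗ Fl q = Fl q) (hFlψ : ∀ q, Fl q ∘ₗ mulOp (fun p : X × ι => (ψ₂X q) p.1) = Fl q)
    (hFlχ' : ∀ q, mulOp (fun p : X' × ι => (χX' q) p.1) ∘ₗ Fl' q = Fl' q) (hFlψ' : ∀ q, Fl' q ∘ₗ mulOp (fun p : X' × ι => (ψ₂X' q) p.1) = Fl' q)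
    (hFl : ∀ q, HasMaj (BlockNorm.ofBlocks g (liftBlk blk ι)) (BlockNorm.ofBlocks g (liftBlk blk ι)) (Fl q) (fun y y' => εFl * Real.exp (-(ρ₁ * g.dist y y'))))
    (hFl' : ∀ q, HasMaj (BlockNorm.ofBlocks g (liftBlk (blk ∘ π) ι)) (BlockNorm.ofBlocks g (liftBlk (blk ∘ π) ι)) (Fl' q) (fun y y' => εFl * Real.exp (-(ρ₁ * g.dist y y'))))
    (hDFl : ∀ q, HasMaj (BlockNorm.ofBlocks g (liftBlk blk ι)) (BlockNorm.ofBlocks g (liftBlk (blk ∘ π) ι)) (idef (pull (liftMap π ι)) (pull (liftMap π ι)) (Fl' q) (Fl q)) (fun y y' => rFl * Real.exp (-(ρ₁ * g.dist y y'))))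
    (hqL : Nov * ((((((Fintype.card J : ℝ) * (3 * ((β + (β₁ + ct * β)) * (1 - (β + (β₁ + ct * β)) * (R * cr) * cr)⁻¹ * c₂) + 2 * (((1 - θA * cr)⁻¹ * βQ * cr) * c₁)) + 0) + (β + (β₁ + ct * β)) * (1 - (β + (β₁ + ct * β)) * (R * cr) * cr)⁻¹ * cN * cr) + (((Fintype.card J : ℝ) * (2 * rA * (c₁ * ((β + (β₁ + ct * β)) * (1 - (β + (β₁ + ct * β)) * (R * cr) * cr)⁻¹) + c₀ * ((1 - θA * cr)⁻¹ * βQ * cr)))) + (β + (β₁ + ct * β)) * (1 - (β + (β₁ + ct * β)) * (R * cr) * cr)⁻¹ * ((ℓ * (Real.exp 1 * ε)⁻¹ + 2 * ω) * RN) * cr)) + θF) + εF) * cr < 1) :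
    HasMaj (BlockNorm.ofBlocks g (liftBlk blk ι)) (BlockNorm.ofBlocks g (liftBlk (blk ∘ π) ι))
      (idef (pull (liftMap π ι)) (pull (liftMap π ι)) (Yop' ∘ₗ bgrad n' (liftEquiv (τ' ν) ι)) (Yop ∘ₗ bgrad n (liftEquiv (τ ν) ι)))
      (fun y y' => (((1 - Nov * ((((((Fintype.card J : ℝ) * (3 * ((β + (β₁ + ct * β)) * (1 - (β + (β₁ + ct * β)) * (R * cr) * cr)⁻¹ * c₂) + 2 * (((1 - θA * cr)⁻¹ * βQ * cr) * c₁)) + 0) + (β + (β₁ + ct * β)) * (1 - (β + (β₁ + ct * β)) * (R * cr) * cr)⁻¹ * cN * cr) + (((Fintype.card J : ℝ) * (2 * rA * (c₁ * ((β + (β₁ + ct * β)) * (1 - (β + (β₁ + ct * β)) * (R * cr) * cr)⁻¹) + c₀ * ((1 - θA * cr)⁻¹ * βQ * cr)))) + (β + (β₁ + ct * β)) * (1 - (β + (β₁ + ct * β)) * (R * cr) * cr)⁻¹ * ((ℓ * (Real.exp 1 * ε)⁻¹ + 2 * ω) * RN) * cr)) + θF) + εF) * cr)⁻¹ * (Nov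 * ((1 * ((1 - θA * cr)⁻¹ * βQ * cr) * os + 1 * (1 * ((1 - θA * cr)⁻¹ * (1 * mQ + oχ * βQ) * cr + (1 - θA * cr)⁻¹ * (r𝒲 * ((1 - θA * cr)⁻¹ * βQ * cr) * cr) * cr) + oχc * ((1 - θA * cr)⁻¹ * βQ * cr)) * 1 + o * ((1 - θA * cr)⁻¹ * βQ * cr) * 1) + (1 * ((β + (β₁ + ct * β)) * (1 - (β + (β₁ + ct * β)) * (R * cr) * cr)⁻¹) * o₁ + 1 * mX * c₁ + o * ((β + (β₁ + ct * β)) * (1 - (β + (β₁ + ct * β)) * (R * cr) * cr)⁻¹) * c₁))) * cr +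
          (1 - Nov * ((((((Fintype.card J : ℝ) * (3 * ((β + (β₁ + ct * β)) * (1 - (β + (β₁ + ct * β)) * (R * cr) * cr)⁻¹ * c₂) + 2 * (((1 - θA * cr)⁻¹ * βQ * cr) * c₁)) + 0) + (β + (β₁ + ct * β)) * (1 - (β + (β₁ + ct * β)) * (R * cr) * cr)⁻¹ * cN * cr) + (((Fintype.card J : ℝ) * (2 * rA * (c₁ * ((β + (β₁ + ct * β)) * (1 - (β + (β₁ + ct * β)) * (R * cr) * cr)⁻¹) + c₀ * ((1 - θA * cr)⁻¹ * βQ * cr)))) + (β + (β₁ + ct * β)) * (1 - (β + (β₁ + ct * β)) * (R * cr) * cr)⁻¹ * ((ℓ * (Real.exp 1 * ε)⁻¹ + 2 * ω) * RN) * cr)) + θF) + εF) * cr)⁻¹ * ((Nov * ((((((Fintype.card J : ℝ) * (3 * (((β + (β₁ + ct * β)) * (1 - (β + (β₁ + ct * β)) * (R * cr) * cr)⁻¹) * o₂ + mX * c₂) + 2 * (((1 - θA * cr)⁻¹ * βQ * cr) * o₁ + ((1 - θA * cr)⁻¹ * (1 * mQ + oχ * βQ) * cr + (1 - θA * cr)⁻¹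 * (r𝒲 * ((1 - θA * cr)⁻¹ * βQ * cr) * cr) * cr) * c₁)) + 0) + ((β + (β₁ + ct * β)) * (1 - (β + (β₁ + ct * β)) * (R * cr) * cr)⁻¹) * rN * cr + mX * cN * cr + ((Fintype.card J : ℝ) * (2 * (rA * (c₁ * mX + o₁ * ((β + (β₁ + ct * β)) * (1 - (β + (β₁ + ct * β)) * (R * cr) * cr)⁻¹) + c₀ * ((1 - θA * cr)⁻¹ * (1 * mQ + oχ * βQ) * cr + (1 - θA * cr)⁻¹ * (r𝒲 * ((1 - θA * cr)⁻¹ * βQ * cr) * cr) * cr) + o₀ * ((1 - θA * cr)⁻¹ * βQ * cr)) + oAt * (c₁ * ((β + (β₁ + ct * β)) * (1 - (β + (β₁ + ct * β)) * (R * cr) * cr)⁻¹) + c₀ * ((1 - θA * cr)⁻¹ * βQ * cr)))) + ((β + (β₁ + ct * β)) * (1 - (β + (β₁ + ct * β)) * (R * cr) * cr)⁻¹) * (((ℓ * (Real.exp 1 * ε)⁻¹ + 2 * ω) * rV + 2 * o * RN)) * cr + mX * ((ℓ * (Real.exp 1 * ε)⁻¹ + 2 * ω) * RN) * cr))) + rFK)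 + o * (((((Fintype.card J : ℝ) * (3 * ((β + (β₁ + ct * β)) * (1 - (β + (β₁ + ct * β)) * (R * cr) * cr)⁻¹ * c₂) + 2 * (((1 - θA * cr)⁻¹ * βQ * cr) * c₁)) + 0) + (β + (β₁ + ct * β)) * (1 - (β + (β₁ + ct * β)) * (R * cr) * cr)⁻¹ * cN * cr) + (((Fintype.card J : ℝ) * (2 * rA * (c₁ * ((β + (β₁ + ct * β)) * (1 - (β + (β₁ + ct * β)) * (R * cr) * cr)⁻¹) + c₀ * ((1 - θA * cr)⁻¹ * βQ * cr)))) + (β + (β₁ + ct * β)) * (1 - (β + (β₁ + ct * β)) * (R * cr) * cr)⁻¹ * ((ℓ * (Real.exp 1 * ε)⁻¹ + 2 * ω) * RN) * cr)) + θF) + (1 * rFE + o * εF))) * ((1 - Nov * ((((((Fintype.card J : ℝ) * (3 * ((β + (β₁ + ct * β)) * (1 - (β + (β₁ + ct * β)) * (R * cr) * cr)⁻¹ * c₂) + 2 * (((1 - θA * cr)⁻¹ * βQ * cr) * c₁)) + 0) + (β + (β₁ + ct * β)) * (1 - (β + (β₁ + ct * β)) * (R * cr) * cr)⁻¹ * cN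 * cr) + (((Fintype.card J : ℝ) * (2 * rA * (c₁ * ((β + (β₁ + ct * β)) * (1 - (β + (β₁ + ct * β)) * (R * cr) * cr)⁻¹) + c₀ * ((1 - θA * cr)⁻¹ * βQ * cr)))) + (β + (β₁ + ct * β)) * (1 - (β + (β₁ + ct * β)) * (R * cr) * cr)⁻¹ * ((ℓ * (Real.exp 1 * ε)⁻¹ + 2 * ω) * RN) * cr)) + θF) + εF) * cr)⁻¹ * (Nov * (((1 - θA * cr)⁻¹ * βQ * cr) * 1 + ((β + (β₁ + ct * β)) * (1 - (β + (β₁ + ct * β)) * (R * cr) * cr)⁻¹) * c₁)) * cr) * cr) * cr) *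
        Real.exp (-((ρ₃ - 2 * σ) * g.dist y y')))) := by
  have hρ₁0 : 0 ≤ ρ₁ := le_trans hσ hσρ
  have hρ₁δ : ρ₁ ≤ δ := by linarith
  have hσρ₃' : 2 * σ ≤ ρ₁ := by linarith
  have hρ₃₁ : ρ₃ ≤ ρ₁ - 2 * σ := by linarith
  have hinv : 0 ≤ (1 - θA * cr)⁻¹ := inv_nonneg.2 (by linarith)
  have rate₁ : ∀ (T : Set g.Site) {c : ℝ}, 0 ≤ c → ∀ y y' : g.Site,
      ind T y * ind T y' * (c * Real.exp (-(δ * g.dist y y'))) ≤ ind T y * ind T y' * (c * Real.exp (-(ρ₁ * g.dist y y'))) :=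
    fun T c hc y y' => mul_le_mul_of_nonneg_left (exp_rate_mono hd hc hρ₁δ y y') (mul_nonneg (ind_nonneg _ _) (ind_nonneg _ _))
  have hθ150 : 0 ≤ β * rC + Fintype.card J * (2 * (βQ * rA + β * r₁)) + β * RN * cr := by positivity
  -- FILE 150 ★★★ at both grids: the adjoint letters of `𝒲_k`, `𝒲′_k`, dominated by `θ_A`
  have hW𝒲 : ∀ q, HasMaj (BlockNorm.ofBlocks g (liftBlk blk ι)) (BlockNorm.ofBlocks g (liftBlk blk ι))
      ((mulOp (fun p : X × ι => (χtX q) p.1) ∘ₗ (N q)) ∘ₗ (unstackM (C q) (A q) + (NV q) ∘ₗ projO (none : Option (J ⊕ J))) ∘ₗ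
        stack LinearMap.id (fun j => Sum.elim (fun μ => fgrad n (liftEquiv (τ μ) ι)) (fun μ => bgrad n (liftEquiv (τ μ) ι)) j) ∘ₗ mulOp (fun p : X × ι => (χX q) p.1))
      (fun y y' => θA * Real.exp (-(ρ₁ * g.dist y y'))) := fun q =>
    (hasMaj_adjW_smoothCut_loc₂ blk τ n htri hd hrow hβ hβQ hrC hrA hr₁ hRN hcr hρ₁0 hρ₁δ hρ₁G hρ₁N (hSχ q) (hχt q) (hχ1 q) (hsub q) (hχ q) (hcut q) (hTf q) (hTb q) (hTfr q) (hTbr q)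
      (hC q) (fun μ x i => hA q (Sum.inl μ) x i) (fun μ x i => hA q (Sum.inr μ) x i) (hgAf q) (hgAb q) (hNV q)).mono fun y y' =>
      (mul_le_of_le_one_left (by positivity) (mul_le_one₀ (ind_le_one _ _) (ind_nonneg _ _) (ind_le_one _ _))).trans (mul_le_mul_of_nonneg_right hθAle (Real.exp_nonneg _))
  have hW𝒲' : ∀ q, HasMaj (BlockNorm.ofBlocks g (liftBlk (blk ∘ π) ι)) (BlockNorm.ofBlocks g (liftBlk (blk ∘ π) ι))
      ((mulOp (fun p : X' × ι => (χtX' q) p.1) ∘ₗ (N' q)) ∘ₗ (unstackM (C' q) (A' q) + (NV' q) ∘ₗ projO (none : Option (J ⊕ J))) ∘ₗ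
        stack LinearMap.id (fun j => Sum.elim (fun μ => fgrad n' (liftEquiv (τ' μ) ι)) (fun μ => bgrad n' (liftEquiv (τ' μ) ι)) j) ∘ₗ mulOp (fun p : X' × ι => (χX' q) p.1))
      (fun y y' => θA * Real.exp (-(ρ₁ * g.dist y y'))) := fun q =>
    (hasMaj_adjW_smoothCut_loc₂ (blk ∘ π) τ' n' htri hd hrow hβ hβQ hrC hrA hr₁ hRN hcr hρ₁0 hρ₁δ hρ₁G hρ₁N (hSχ' q) (hχt' q) (hχ1' q) (hsub' q) (hχ' q) (hcut' q) (hTf' q) (hTb' q)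
      (hTfr' q) (hTbr' q) (hC' q) (fun μ x i => hA' q (Sum.inl μ) x i) (fun μ x i => hA' q (Sum.inr μ) x i) (hgAf' q) (hgAb' q) (hNV' q)).mono fun y y' =>
      (mul_le_of_le_one_left (by positivity) (mul_le_one₀ (ind_le_one _ _) (ind_nonneg _ _) (ind_le_one _ _))).trans (mul_le_mul_of_nonneg_right hθAle (Real.exp_nonneg _))
  -- FILE 151 ★★★: their η-defect, dominated by `r_𝒲`
  have hD𝒲 : ∀ q, HasMaj (BlockNorm.ofBlocks g (liftBlk blk ι)) (BlockNorm.ofBlocks g (liftBlk (blk ∘ π) ι))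
      (idef (pull (liftMap π ι)) (pull (liftMap π ι))
        ((mulOp (fun p : X' × ι => (χtX' q) p.1) ∘ₗ (N' q)) ∘ₗ (unstackM (C' q) (A' q) + (NV' q) ∘ₗ projO (none : Option (J ⊕ J))) ∘ₗ
        stack LinearMap.id (fun j => Sum.elim (fun μ => fgrad n' (liftEquiv (τ' μ) ι)) (fun μ => bgrad n' (liftEquiv (τ' μ) ι)) j) ∘ₗ mulOp (fun p : X' × ι => (χX' q) p.1))
        ((mulOp (fun p : X × ι => (χtX q) p.1) ∘ₗ (N q)) ∘ₗ (unstackM (C q) (A q) + (NV q) ∘ₗ projO (none : Option (J ⊕ J))) ∘ₗ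
        stack LinearMap.id (fun j => Sum.elim (fun μ => fgrad n (liftEquiv (τ μ) ι)) (fun μ => bgrad n (liftEquiv (τ μ) ι)) j) ∘ₗ mulOp (fun p : X × ι => (χX q) p.1)))
      (fun y y' => r𝒲 * Real.exp (-(ρ₁ * g.dist y y'))) := fun q =>
    (hasMaj_idef_adjW_smoothCut_loc₂ blk π τ τ' n n' htri hd hrow hβ hβQ hrC hrA hr₁ hRN hmN hmT hoC hoAt hog hrV hoχ hcr hρ₁0 hρ₁δ hρ₁G hρ₁N (hSχ q) (hSχ' q) (hχt' q) (hχ1 q) (hχ1' q)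
      (hχπ q) (hfitχ q) (hsub q) (hsub' q) (hχ q) (hχ' q) (hχχ q) (hχχ' q) (hcut q) (hcut' q) (hIcut q) (hTf q) (hTb q) (hTf' q) (hTb' q) (hTfr q) (hTbr q) (hTfr' q) (hTbr' q)
      (hITf q) (hITb q) (hC q) (fun μ x i => hA q (Sum.inl μ) x i) (fun μ x i => hA q (Sum.inr μ) x i) (hgAf q) (hgAb q) (hfC q) (hfAb q) (hfAf q) (hfgAf q) (hfgAb q)
      (hNV q) (hDNV q)).mono fun y y' =>
      (mul_le_of_le_one_left (by positivity) (mul_le_one₀ (ind_le_one _ _) (ind_nonneg _ _) (ind_le_one _ _))).trans (mul_le_mul_of_nonneg_right hr𝒲le (Real.exp_nonneg _))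
  -- the units, per cube, both grids (as in n15-c∕169)
  have hβb : 0 ≤ β + (β₁ + ct * β) := by positivity
  have hGf := fun q => hasMaj_smoothCut_flat blk (S := Sk q) hβ hβ₁ hct (hχt q) (hsub q) (hcut q)
  have hDf := fun q => hasMaj_jet_smoothCut_flat blk τ n (S := Sk q) hβ hβ₁ hct (hχt q) (hdχt q) (hdχtb q) (hs q) (hsb q) (hdd q) (hddb q) (hcut q) (hcutF q) (hcutB q)
  have hunit := fun q => (hasMaj_dressedV_pair blk htri hd hrow hσ hβb hR hcr hσρ hρ₁V hρ₁G hρ₂ hρ₂₁ (hGf q) (hDf q) (hV q) hq).1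
  have hunitW := fun q => isUnit_neumannR (liftBlk blk ι) hd hrow hθA (by linarith) (hW𝒲 q) hqA
  have hDj : ∀ q, ∀ j, (fun j => Sum.elim (fun μ => fgrad n (liftEquiv (τ μ) ι)) (fun μ => bgrad n (liftEquiv (τ μ) ι)) j ∘ₗ (mulOp (fun p : X × ι => (χtX q) p.1) ∘ₗ (N q))) j = (fun j => Sum.elim (fun μ => fgrad n (liftEquiv (τ μ) ι)) (fun μ => bgrad n (liftEquiv (τ μ) ι)) j) j ∘ₗ (mulOp (fun p : X × ι => (χtX q) p.1) ∘ₗ (N q)) := fun _ _ => rfl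
  have hGf' := fun q => hasMaj_smoothCut_flat (blk ∘ π) (S := Sk q) hβ hβ₁ hct (hχt' q) (hsub' q) (hcut' q)
  have hDf' := fun q => hasMaj_jet_smoothCut_flat (blk ∘ π) τ' n' (S := Sk q) hβ hβ₁ hct (hχt' q) (hdχt' q) (hdχtb' q) (hs' q) (hsb' q) (hdd' q) (hddb' q) (hcut' q) (hcutF' q) (hcutB' q)
  have hunit' := fun q => (hasMaj_dressedV_pair (blk ∘ π) htri hd hrow hσ hβb hR hcr hσρ hρ₁V hρ₁G hρ₂ hρ₂₁ (hGf' q) (hDf' q) (hV' q) hq).1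
  have hunitW' := fun q => isUnit_neumannR (liftBlk (blk ∘ π) ι) hd hrow hθA (by linarith) (hW𝒲' q) hqA
  have hDj' : ∀ q, ∀ j, (fun j => Sum.elim (fun μ => fgrad n' (liftEquiv (τ' μ) ι)) (fun μ => bgrad n' (liftEquiv (τ' μ) ι)) j ∘ₗ (mulOp (fun p : X' × ι => (χtX' q) p.1) ∘ₗ (N' q))) j = (fun j => Sum.elim (fun μ => fgrad n' (liftEquiv (τ' μ) ι)) (fun μ => bgrad n' (liftEquiv (τ' μ) ι)) j) j ∘ₗ (mulOp (fun p : X' × ι => (χtX' q) p.1) ∘ₗ (N' q)) := fun _ _ => rfl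
  have hWχ : ∀ q, mulOp (fun p : X × ι => (χX q) p.1) ∘ₗ ((mulOp (fun p : X × ι => (χtX q) p.1) ∘ₗ (N q)) ∘ₗ (unstackM (C q) (A q) + (NV q) ∘ₗ projO (none : Option (J ⊕ J))) ∘ₗ
        stack LinearMap.id (fun j => Sum.elim (fun μ => fgrad n (liftEquiv (τ μ) ι)) (fun μ => bgrad n (liftEquiv (τ μ) ι)) j) ∘ₗ mulOp (fun p : X × ι => (χX q) p.1)) =
      ((mulOp (fun p : X × ι => (χtX q) p.1) ∘ₗ (N q)) ∘ₗ (unstackM (C q) (A q) + (NV q) ∘ₗ projO (none : Option (J ⊕ J))) ∘ₗ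
        stack LinearMap.id (fun j => Sum.elim (fun μ => fgrad n (liftEquiv (τ μ) ι)) (fun μ => bgrad n (liftEquiv (τ μ) ι)) j) ∘ₗ mulOp (fun p : X × ι => (χX q) p.1)) := fun q => by
    simp only [← LinearMap.comp_assoc]
    rw [hχ q]
  have hWχ' : ∀ q, mulOp (fun p : X' × ι => (χX' q) p.1) ∘ₗ ((mulOp (fun p : X' × ι => (χtX' q) p.1) ∘ₗ (N' q)) ∘ₗ (unstackM (C' q) (A' q) + (NV' q) ∘ₗ projO (none : Option (J ⊕ J))) ∘ₗ
        stack LinearMap.id (fun j => Sum.elim (fun μ => fgrad n' (liftEquiv (τ' μ) ι)) (fun μ => bgrad n' (liftEquiv (τ' μ) ι)) j) ∘ₗ mulOp (fun p : X' × ι => (χX' q) p.1)) =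
      ((mulOp (fun p : X' × ι => (χtX' q) p.1) ∘ₗ (N' q)) ∘ₗ (unstackM (C' q) (A' q) + (NV' q) ∘ₗ projO (none : Option (J ⊕ J))) ∘ₗ
        stack LinearMap.id (fun j => Sum.elim (fun μ => fgrad n' (liftEquiv (τ' μ) ι)) (fun μ => bgrad n' (liftEquiv (τ' μ) ι)) j) ∘ₗ mulOp (fun p : X' × ι => (χX' q) p.1)) := fun q => by
    simp only [← LinearMap.comp_assoc]
    rw [hχ' q]
  -- FILE 148: the true right-locality defects `Ẽ = Ñ_𝒲∘F^flat` at both grids, exactly; their two-sided rows; their η-defect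
  have hloc : ∀ q, (projO none ∘ₗ bgPropV (stack (mulOp (fun p : X × ι => (χtX q) p.1) ∘ₗ (N q)) (fun j => Sum.elim (fun μ => fgrad n (liftEquiv (τ μ) ι)) (fun μ => bgrad n (liftEquiv (τ μ) ι)) j ∘ₗ (mulOp (fun p : X × ι => (χtX q) p.1) ∘ₗ (N q)))) (unstackM ((C q)) ((A q)) + (NV q) ∘ₗ projO (none : Option (J ⊕ J)))) ∘ₗ Δ ∘ₗ mulOp (fun p : X × ι => (hX q) p.1) =
      mulOp (fun p : X × ι => (hX q) p.1) + neumannR ((mulOp (fun p : X × ι => (χtX q) p.1) ∘ₗ (N q)) ∘ₗ (unstackM (C q) (A q) + (NV q) ∘ₗ projO (none : Option (J ⊕ J))) ∘ₗ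
        stack LinearMap.id (fun j => Sum.elim (fun μ => fgrad n (liftEquiv (τ μ) ι)) (fun μ => bgrad n (liftEquiv (τ μ) ι)) j) ∘ₗ mulOp (fun p : X × ι => (χX q) p.1)) ∘ₗ Fl q := fun q => by
    have h := projO_dressedV_comp_lap_mulOp (hDj q) (hunit q) (smoothCut_out (hχ q)) (hunitW q) (Δ₀ := lapOp n (fun μ => liftEquiv (τ μ) ι) 0 + NL)
      (Vt := (unstackM ((C q)) ((A q)) + (NV q) ∘ₗ projO (none : Option (J ⊕ J))) ∘ₗ stack LinearMap.id (fun j => Sum.elim (fun μ => fgrad n (liftEquiv (τ μ) ι)) (fun μ => bgrad n (liftEquiv (τ μ) ι)) j)) (Vm := 0) (hcov₀ q) (hflat q) (by rw [add_zero]) (hFlχ q)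
    rw [LinearMap.comp_zero, add_zero] at h
    exact h
  have hloc' : ∀ q, (projO none ∘ₗ bgPropV (stack (mulOp (fun p : X' × ι => (χtX' q) p.1) ∘ₗ (N' q)) (fun j => Sum.elim (fun μ => fgrad n' (liftEquiv (τ' μ) ι)) (fun μ => bgrad n' (liftEquiv (τ' μ) ι)) j ∘ₗ (mulOp (fun p : X' × ι => (χtX' q) p.1) ∘ₗ (N' q)))) (unstackM ((C' q)) ((A' q)) + (NV' q) ∘ₗ projO (none : Option (J ⊕ J)))) ∘ₗ Δ' ∘ₗ mulOp (fun p : X' × ι => (hX' q) p.1) =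
      mulOp (fun p : X' × ι => (hX' q) p.1) + neumannR ((mulOp (fun p : X' × ι => (χtX' q) p.1) ∘ₗ (N' q)) ∘ₗ (unstackM (C' q) (A' q) + (NV' q) ∘ₗ projO (none : Option (J ⊕ J))) ∘ₗ
        stack LinearMap.id (fun j => Sum.elim (fun μ => fgrad n' (liftEquiv (τ' μ) ι)) (fun μ => bgrad n' (liftEquiv (τ' μ) ι)) j) ∘ₗ mulOp (fun p : X' × ι => (χX' q) p.1)) ∘ₗ Fl' q := fun q => by
    have h := projO_dressedV_comp_lap_mulOp (hDj' q) (hunit' q) (smoothCut_out (hχ' q)) (hunitW' q) (Δ₀ := lapOp n' (fun μ => liftEquiv (τ' μ) ι) 0 + NL')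
      (Vt := (unstackM ((C' q)) ((A' q)) + (NV' q) ∘ₗ projO (none : Option (J ⊕ J))) ∘ₗ stack LinearMap.id (fun j => Sum.elim (fun μ => fgrad n' (liftEquiv (τ' μ) ι)) (fun μ => bgrad n' (liftEquiv (τ' μ) ι)) j)) (Vm := 0) (hcov₀' q) (hflat' q) (by rw [add_zero]) (hFlχ' q)
    rw [LinearMap.comp_zero, add_zero] at h
    exact h
  have hEd : ∀ q, HasMaj (BlockNorm.ofBlocks g (liftBlk blk ι)) (BlockNorm.ofBlocks g (liftBlk blk ι)) (neumannR ((mulOp (fun p : X × ι => (χtX q) p.1) ∘ₗ (N q)) ∘ₗ (unstackM (C q) (A q) + (NV q) ∘ₗ projO (none : Option (J ⊕ J))) ∘ₗ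
        stack LinearMap.id (fun j => Sum.elim (fun μ => fgrad n (liftEquiv (τ μ) ι)) (fun μ => bgrad n (liftEquiv (τ μ) ι)) j) ∘ₗ mulOp (fun p : X × ι => (χX q) p.1)) ∘ₗ Fl q)
      (fun y y' => ind (Sk q) y * ind (Sk q) y' * (εF * Real.exp (-(ρ₃ * g.dist y y')))) := fun q =>
    (hasMaj_neumannR_comp_loc₂ blk htri hd hd0 hrow hσ hcr (hSχ q) (hSψ₂ q) (hWχ q) (hFlχ q) (hFlψ q) hεFl hθA hσρ₃' (hW𝒲 q) (hFl q) hqA).mono fun y y' =>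
      mul_le_mul_of_nonneg_left ((exp_rate_mono hd (c := (1 - θA * cr)⁻¹ * εFl * cr) (by positivity) hρ₃₁ y y').trans
        (mul_le_mul_of_nonneg_right hεFle (Real.exp_nonneg _))) (mul_nonneg (ind_nonneg _ _) (ind_nonneg _ _))
  have hEd' : ∀ q, HasMaj (BlockNorm.ofBlocks g (liftBlk (blk ∘ π) ι)) (BlockNorm.ofBlocks g (liftBlk (blk ∘ π) ι)) (neumannR ((mulOp (fun p : X' × ι => (χtX' q) p.1) ∘ₗ (N' q)) ∘ₗ (unstackM (C' q) (A' q) + (NV' q) ∘ₗ projO (none : Option (J ⊕ J))) ∘ₗ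
        stack LinearMap.id (fun j => Sum.elim (fun μ => fgrad n' (liftEquiv (τ' μ) ι)) (fun μ => bgrad n' (liftEquiv (τ' μ) ι)) j) ∘ₗ mulOp (fun p : X' × ι => (χX' q) p.1)) ∘ₗ Fl' q)
      (fun y y' => ind (Sk q) y * ind (Sk q) y' * (εF * Real.exp (-(ρ₃ * g.dist y y')))) := fun q =>
    (hasMaj_neumannR_comp_loc₂ (blk ∘ π) htri hd hd0 hrow hσ hcr (hSχ' q) (hSψ₂' q) (hWχ' q) (hFlχ' q) (hFlψ' q) hεFl hθA hσρ₃' (hW𝒲' q) (hFl' q) hqA).mono fun y y' =>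
      mul_le_mul_of_nonneg_left ((exp_rate_mono hd (c := (1 - θA * cr)⁻¹ * εFl * cr) (by positivity) hρ₃₁ y y').trans
        (mul_le_mul_of_nonneg_right hεFle (Real.exp_nonneg _))) (mul_nonneg (ind_nonneg _ _) (ind_nonneg _ _))
  have hrFE0 : 0 ≤ (1 - θA * cr)⁻¹ * rFl * cr + (1 - θA * cr)⁻¹ * (r𝒲 * ((1 - θA * cr)⁻¹ * εFl * cr) * cr) * cr := by positivity
  have hDEd : ∀ q, HasMaj (BlockNorm.ofBlocks g (liftBlk blk ι)) (BlockNorm.ofBlocks g (liftBlk (blk ∘ π) ι))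
      (idef (pull (liftMap π ι)) (pull (liftMap π ι)) (neumannR ((mulOp (fun p : X' × ι => (χtX' q) p.1) ∘ₗ (N' q)) ∘ₗ (unstackM (C' q) (A' q) + (NV' q) ∘ₗ projO (none : Option (J ⊕ J))) ∘ₗ
        stack LinearMap.id (fun j => Sum.elim (fun μ => fgrad n' (liftEquiv (τ' μ) ι)) (fun μ => bgrad n' (liftEquiv (τ' μ) ι)) j) ∘ₗ mulOp (fun p : X' × ι => (χX' q) p.1)) ∘ₗ Fl' q) (neumannR ((mulOp (fun p : X × ι => (χtX q) p.1) ∘ₗ (N q)) ∘ₗ (unstackM (C q) (A q) + (NV q) ∘ₗ projO (none : Option (J ⊕ J))) ∘ₗ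
        stack LinearMap.id (fun j => Sum.elim (fun μ => fgrad n (liftEquiv (τ μ) ι)) (fun μ => bgrad n (liftEquiv (τ μ) ι)) j) ∘ₗ mulOp (fun p : X × ι => (χX q) p.1)) ∘ₗ Fl q))
      (fun y y' => ind (Sk q) y * ind (Sk q) y' * (rFE * Real.exp (-(ρ₃ * g.dist y y')))) := fun q =>
    (hasMaj_idef_neumannR_comp_loc₂ blk π htri hd hd0 hrow hσ hcr (hSχ q) (hSψ₂ q) (hSχ' q) (hSψ₂' q) (hWχ q) (hFlχ q) (hFlψ q) (hWχ' q) (hFlχ' q) (hFlψ' q) hεFl hθA hrFl hr𝒲 hσρ₃'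
      (hW𝒲 q) (hW𝒲' q) (hD𝒲 q) (hFl q) (hDFl q) hqA).mono fun y y' =>
      mul_le_mul_of_nonneg_left ((exp_rate_mono hd hrFE0 hρ₃₁ y y').trans (mul_le_mul_of_nonneg_right hrFEle (Real.exp_nonneg _))) (mul_nonneg (ind_nonneg _ _) (ind_nonneg _ _))
  -- no far defect at either grid
  have hc0 : ∀ q, commOp (0 : (X × ι → ℝ) →ₗ[ℝ] (X × ι → ℝ)) (fun p : X × ι => (hX q) p.1) = 0 := fun q => by simp [commOp]
  have hc0' : ∀ q, commOp (0 : (X' × ι → ℝ) →ₗ[ℝ] (X' × ι → ℝ)) (fun p : X' × ι => (hX' q) p.1) = 0 := fun q => by simp [commOp]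
  have hFK : ∀ q, HasMaj (BlockNorm.ofBlocks g (liftBlk blk ι)) (BlockNorm.ofBlocks g (liftBlk blk ι)) ((projO none ∘ₗ bgPropV (stack (mulOp (fun p : X × ι => (χtX q) p.1) ∘ₗ (N q)) (fun j => Sum.elim (fun μ => fgrad n (liftEquiv (τ μ) ι)) (fun μ => bgrad n (liftEquiv (τ μ) ι)) j ∘ₗ (mulOp (fun p : X × ι => (χtX q) p.1) ∘ₗ (N q)))) (unstackM ((C q)) ((A q)) + (NV q) ∘ₗ projO (none : Option (J ⊕ J)))) ∘ₗ commOp (0 : (X × ι → ℝ) →ₗ[ℝ] (X × ι → ℝ)) (fun p : X × ι => (hX q) p.1))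
      (fun y y' => ind (Sk q) y * (θF * Real.exp (-(ρ₃ * g.dist y y')))) := fun q => by
    rw [hc0 q, LinearMap.comp_zero]
    exact (hasMaj_zero _ _).mono fun y y' => mul_nonneg (ind_nonneg _ _) (mul_nonneg hθF (Real.exp_nonneg _))
  have hFK' : ∀ q, HasMaj (BlockNorm.ofBlocks g (liftBlk (blk ∘ π) ι)) (BlockNorm.ofBlocks g (liftBlk (blk ∘ π) ι)) ((projO none ∘ₗ bgPropV (stack (mulOp (fun p : X' × ι => (χtX' q) p.1) ∘ₗ (N' q)) (fun j => Sum.elim (fun μ => fgrad n' (liftEquiv (τ' μ) ι)) (fun μ => bgrad n' (liftEquiv (τ' μ) ι)) j ∘ₗ (mulOp (fun p : X' × ι => (χtX' q) p.1) ∘ₗ (N' q)))) (unstackM ((C' q)) ((A' q)) + (NV' q) ∘ₗ projO (none : Option (J ⊕ J)))) ∘ₗ commOp (0 : (X' × ι → ℝ) →ₗ[ℝ] (X' × ι → ℝ)) (fun p : X' × ι => (hX' q) p.1))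
      (fun y y' => ind (Sk q) y * (θF * Real.exp (-(ρ₃ * g.dist y y')))) := fun q => by
    rw [hc0' q, LinearMap.comp_zero]
    exact (hasMaj_zero _ _).mono fun y y' => mul_nonneg (ind_nonneg _ _) (mul_nonneg hθF (Real.exp_nonneg _))
  have hDFK : ∀ q, HasMaj (BlockNorm.ofBlocks g (liftBlk blk ι)) (BlockNorm.ofBlocks g (liftBlk (blk ∘ π) ι)) (idef (pull (liftMap π ι)) (pull (liftMap π ι))
      ((projO none ∘ₗ bgPropV (stack (mulOp (fun p : X' × ι => (χtX' q) p.1) ∘ₗ (N' q)) (fun j => Sum.elim (fun μ => fgrad n' (liftEquiv (τ' μ) ι)) (fun μ => bgrad n' (liftEquiv (τ' μ) ι)) j ∘ₗ (mulOp (fun p : X' × ι => (χtX' q) p.1) ∘ₗ (N' q)))) (unstackM ((C' q)) ((A' q)) + (NV' q) ∘ₗ projO (none : Option (J ⊕ J)))) ∘ₗ commOp (0 : (X' × ι → ℝ) →ₗ[ℝ] (X' × ι → ℝ)) (fun p : X' × ι => (hX' q) p.1)) ((projO none ∘ₗ bgPropV (stack (mulOp (fun p : X × ι => (χtX q) p.1)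 ∘ₗ (N q)) (fun j => Sum.elim (fun μ => fgrad n (liftEquiv (τ μ) ι)) (fun μ => bgrad n (liftEquiv (τ μ) ι)) j ∘ₗ (mulOp (fun p : X × ι => (χtX q) p.1) ∘ₗ (N q)))) (unstackM ((C q)) ((A q)) + (NV q) ∘ₗ projO (none : Option (J ⊕ J)))) ∘ₗ commOp (0 : (X × ι → ℝ) →ₗ[ℝ] (X × ι → ℝ)) (fun p : X × ι => (hX q) p.1)))
      (fun y y' => ind (Sk q) y * (rFK * Real.exp (-(ρ₃ * g.dist y y')))) := fun q => by
    rw [hc0 q, hc0' q, LinearMap.comp_zero, LinearMap.comp_zero, idef_zero]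
    exact (hasMaj_zero _ _).mono fun y y' => mul_nonneg (ind_nonneg _ _) (mul_nonneg hrFK (Real.exp_nonneg _))
  exact hasMaj_idef_rightInverse_bgrad_smoothCutDressed blk π τ τ' n n' ν (F := fun _ => 0) (F' := fun _ => 0) htri hd hsymm hd0 hrow hσ hβ hβ₁ hβQ hct hR hcr hc₀ hc₁ hc₂ ho₀ ho₁ ho₂ ho hcN hrN hrA hoAt hRN hrV hℓ hω hθA hmX hmQ hr𝒲 hoχ hε hθF hεF hrFK hrFE hos hoχc hNov hσρ hρ₁V hρ₁G hρ₂ hρ₂₁ hρ₃ hρ₃N hρ₃V hρ₃₂ hρ₂W hσρ₃ hSχ hSψ₂ hχt hdχt hdχtb hsub hχ hs hsb hdd hddb hSχ' hSψ' hSψ₂' hχt' hdχt' hdχtb' hsub' hχ' hs' hsb' hdd' hddb' hNψ' hfitχ hcut hcutF hcutB hcut' hcutF' hcutB' hTf hTb hTf' hTb' (fun q μ => (hTfr q μ).mono (rate₁ (Sk q) hβQ)) (fun q μ => (hTbr q μ).mono (rate₁ (Sk q) hβQ)) (fun q μ => (hTfr' q μ).mono (rate₁ (Sk q) hβQ)) (fun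 q μ => (hTbr' q μ).mono (rate₁ (Sk q) hβQ)) hTfψ hTbψ hTfψ' hTbψ' (fun q μ => (hDTf q μ).mono fun y y' => exp_rate_mono hd hmQ hρ₁δ y y') (fun q μ => (hDTb q μ).mono fun y y' => exp_rate_mono hd hmQ hρ₁δ y y') hV hV' hq hW𝒲 hW𝒲' hqA hD𝒲 hDG0 hhD hhB hh2 hh2f hh2b hfD hfB hf2 hf2f hf2b hh1 hh1b hh0 hh1' hh1b' hh0' hf1 hf1b hf0 hf0b hfit hLip hrh hrh' hlayf hlayb hlayf' hlayb' hA hfAb hfAf hKN hDKN hNV hNV' hDNV hSψ hNψ hχ1 hχ1' hfitχc hhabs hhabs' hhcut hhcut' hlayν hlayν' hfits hh2' hh2f' hh2b' hA' hKN' hFK hFK' hDFK hN (fun q => by rw [add_zero]; exact hcov₀ q) (fun q => by rw [add_zero]; exact hcov₀' q) hloc hloc' hEd hEd' hDEd h236 h236' hY hY' hqL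

end Summit.QuantumFields.YangMills.BalabanUVNodes.N15.Gluing

end
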